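import Summits.AtomisticToContinuum.HydrodynamicLimit.Theorems.LambertianContactSwapLambertianEulerWindowPieces
import Summits.AtomisticToContinuum.HydrodynamicLimit.Theorems.LambertianContactSwapLambertianWellPosedPhaseLift

/-!
# The Lambertian hard-sphere flow over a short window: Liouville ⊗ noise sub-invariance

Helper file (`--supports`) of crux `LambertianEuler` (`AtomisticToContinuum/HydrodynamicLimit`,
stmt-AtomisticToContinuum-11854), line `Sketch`: **stub `stub_windowLambda`**, the WINDOW step of the
Liouville ⊗ noise invariance of the Lambertian hard-sphere flow `Λ` on `𝕋³` — the Λ-analogue of the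
deterministic `Alexander.volume_shortGood_inter_preimage_fwdFlow_le` /
`Alexander.fwdGoodUpTo_of_mem_shortGood` (GST 2013, proof of Prop. 4.1.1).

The new input with respect to `…LambertianEulerWindowPieces` is the **one-pair transport inequality of
the Lambertian pre-kick** `J_ξ z = S_{-τ₀} ∘ C_{ij} ∘ L_{ij,ξ} ∘ S_{τ₀} z`
(`lintegral_hitPiece_lambertKick_le`): for measurable `F ≥ 0`,
`∫_{hitPiece(r) ∩ shell} ∫ F (J_ξ z) dγ(ξ) dz ≤ ∫_{hitPiece(2Vδ) ∩ shell} F`. In the relative coordinates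
`Ξ = shearAt i (z ↦ -z_j)` of `Alexander.volume_image_pairCollide` the pre-kick redraws coordinate `i`
by the one-particle redraw of `HalfAngle.lintegral_phase_redraw` (which preserves Haar × Lebesgue
measure on the good pair data: the cosine law of the redraw) and translates coordinate `j`
(`LWindow.lambertKick_apply_pair`), so `HalfAngle.lintegral_lift_redraw` and the invariance of volume
under shears give `∫_{hit ∩ shell} ∫ F ∘ J_ξ dγ ≤ ∫ F` (`lintegral_lambertKick_le`); and `J_ξ z` lies in
`hitPiece(2Vδ) ∩ shell` for a.e. `ξ` (`LWindow.hitHyp_lambertKick`).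
-/

noncomputable section

open MeasureTheory ProbabilityTheory Set Function Filter Metric
open scoped ENNReal InnerProductSpace Real BigOperators

namespace Summit.AtomisticToContinuum.HydrodynamicLimit.Theorems

open Literature.MathematicalPhysics.KineticTheory Literature.Analysis.FluidPDE
  Literature.Analysis.FluidPDE.Alexander

namespace LambertianContactSwapLambertianEulerWindow

open LWindow HalfAngle LambertianContactSwapLambertianEulerWindowPieces

variable {N : ℕ} {ε r δ V : ℝ} {i j : Fin N}

/-! ## The pre-kick does not gain volume -/

section Transport

/-- **Sub-invariance of `vol ⊗ γ` under the Lambertian pre-kick** (the cosine law of the redraw,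
lifted to `N` particles): for measurable `F ≥ 0`, on the hit piece of `(i, j)` of the energy shell
`E ≤ V²/2` (`2Vδ ≤ r`, `ε + 2r < 1/2`), `∫_{hit ∩ shell} ∫ F (J_ξ z) dγ(ξ) dz ≤ ∫ F`. In relative
coordinates `Ξ = shearAt i (z ↦ -z_j)` the pre-kick redraws coordinate `i` by the measure-preserving
one-particle redraw `a ↦ proj(n − τ₀ u', u')` and translates coordinate `j` by `(−τ₀ b, b)`,
`b = ½ (w − u')` (`LWindow.lambertKick_apply_pair`, `HalfAngle.lintegral_lift_redraw`,
`HalfAngle.lintegral_phase_redraw`), and shears preserve volume. [folklore] -/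
theorem lintegral_lambertKick_le (hε : 0 < ε) (hεr : ε + 2 * r < 2⁻¹) (hr : 2 * V * δ ≤ r)
    (hV0 : 0 ≤ V) (hδ : 0 ≤ δ) (hij : i < j) {F : Config N (Fin 3) T3 → ℝ≥0∞} (hF : Measurable F) :
    ∫⁻ z in hitPiece N ε r δ i j ∩ {z | configEnergy z ≤ V ^ 2 / 2},
        ∫⁻ ξ, F (freeFlight (Torus.geometry (Fin 3))
          (-pairHitTime ε ((Torus.geometry (Fin 3)).sepVec (z i).1 (z j).1) ((z i).2 - (z j).2))
          (collidePair (Torus.geometry (Fin 3)) i j (lambertPair (Torus.geometry (Fin 3)) i j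
            (freeFlight (Torus.geometry (Fin 3))
              (pairHitTime ε ((Torus.geometry (Fin 3)).sepVec (z i).1 (z j).1) ((z i).2 - (z j).2)) z) ξ)))
          ∂(stdGaussian V3) ≤ ∫⁻ z, F z := by
  have hne : i ≠ j := ne_of_lt hij
  -- the pre-kick, the redrawn relative velocity, the half-impulse, the one-particle redraw and the
  -- partner translation
  set J : V3 → Config N (Fin 3) T3 → Config N (Fin 3) T3 := fun ξ z => freeFlight (Torus.geometry (Fin 3))
    (-pairHitTime ε ((Torus.geometry (Fin 3)).sepVec (z i).1 (z j).1) ((z i).2 - (z j).2))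
    (collidePair (Torus.geometry (Fin 3)) i j (lambertPair (Torus.geometry (Fin 3)) i j
      (freeFlight (Torus.geometry (Fin 3))
        (pairHitTime ε ((Torus.geometry (Fin 3)).sepVec (z i).1 (z j).1) ((z i).2 - (z j).2)) z) ξ)) with hJ
  set U : V3 → V3 × V3 → V3 := fun ξ u => ‖u.2‖ • (lambertDir (hitPoint ε u) ξ -
    (2 * ⟪lambertDir (hitPoint ε u) ξ, hitPoint ε u⟫_ℝ / ‖hitPoint ε u‖ ^ 2) • hitPoint ε u) with hU
  set Bi : V3 → V3 × V3 → V3 := fun ξ u => (2 : ℝ)⁻¹ • (u.2 - U ξ u) with hBi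
  set T : V3 → T3 × V3 → T3 × V3 := fun ξ a => projPhase (hitPoint ε (liftPhase a) -
    pairHitTime ε (liftPhase a).1 (liftPhase a).2 • U ξ (liftPhase a), U ξ (liftPhase a)) with hT
  set c : V3 → T3 × V3 → T3 × V3 := fun ξ a => (-Literature.Analysis.FunctionSpaces.Torus.proj
    (pairHitTime ε (liftPhase a).1 (liftPhase a).2 • Bi ξ (liftPhase a)), Bi ξ (liftPhase a)) with hc
  show ∫⁻ z in hitPiece N ε r δ i j ∩ {z | configEnergy z ≤ V ^ 2 / 2},
    ∫⁻ ξ, F (J ξ z) ∂(stdGaussian V3) ≤ ∫⁻ z, F z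
  -- measurability of the one-particle maps
  have hn : Measurable fun q : V3 × (V3 × V3) => hitPoint ε q.2 := (measurable_hitPoint ε).comp measurable_snd
  have hτ : Measurable fun q : V3 × (V3 × V3) => pairHitTime ε q.2.1 q.2.2 :=
    (measurable_pairHitTime ε).comp measurable_snd
  have hUm : Measurable fun q : V3 × (V3 × V3) => U q.1 q.2 := by
    have hd : Measurable fun q : V3 × (V3 × V3) => lambertDir (hitPoint ε q.2) q.1 :=
      hn.lambertDir measurable_fst
    exact (measurable_snd.comp measurable_snd).norm.smul
      (hd.sub (((measurable_const.mul (hd.inner hn)).div (hn.norm.pow_const 2)).smul hn))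
  have hBm : Measurable fun q : V3 × (V3 × V3) => Bi q.1 q.2 :=
    ((measurable_snd.comp measurable_snd).sub hUm).const_smul ((2 : ℝ)⁻¹)
  have hL : Measurable fun p : V3 × (T3 × V3) => (p.1, liftPhase p.2) :=
    measurable_fst.prodMk (measurable_liftPhase.comp measurable_snd)
  have hTm : Measurable fun p : V3 × (T3 × V3) => T p.1 p.2 := by
    change Measurable (projPhase ∘ (fun q : V3 × (V3 × V3) =>
      (hitPoint ε q.2 - pairHitTime ε q.2.1 q.2.2 • U q.1 q.2, U q.1 q.2)) ∘ fun p : V3 × (T3 × V3) =>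
        (p.1, liftPhase p.2))
    exact measurable_projPhase.comp (((hn.sub (hτ.smul hUm)).prodMk hUm).comp hL)
  have hcm : Measurable fun p : V3 × (T3 × V3) => c p.1 p.2 := by
    change Measurable ((fun q : V3 × (V3 × V3) => ((-Literature.Analysis.FunctionSpaces.Torus.proj
      (pairHitTime ε q.2.1 q.2.2 • Bi q.1 q.2) : T3), Bi q.1 q.2)) ∘ fun p : V3 × (T3 × V3) =>
        (p.1, liftPhase p.2))
    exact ((Literature.Analysis.FunctionSpaces.Torus.measurable_proj.comp (hτ.smul hBm)).neg.prodMk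
      hBm).comp hL
  -- the factorisation of the pre-kick in relative coordinates (chart condition)
  have hfac : ∀ (z : Config N (Fin 3) T3) (ξ : V3),
      ‖(Torus.geometry (Fin 3)).sepVec (z i).1 (z j).1‖ +
        |pairHitTime ε ((Torus.geometry (Fin 3)).sepVec (z i).1 (z j).1) ((z i).2 - (z j).2)| *
          ‖(z i).2 - (z j).2‖ < 1 / 2 →
      shearAt i (fun z => -z j) (J ξ z) =
        update (update (shearAt i (fun z => -z j) z) i (T ξ (shearAt i (fun z => -z j) z i))) j
          (shearAt i (fun z => -z j) z j + c ξ (shearAt i (fun z => -z j) z i)) := by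
    intro z ξ hch
    set q : V3 := (Torus.geometry (Fin 3)).sepVec (z i).1 (z j).1 with hq
    set w : V3 := (z i).2 - (z j).2 with hw
    set τ₀ : ℝ := pairHitTime ε q w with hτ₀
    set n : V3 := hitPoint ε (q, w) with hn'
    set u' : V3 := U ξ (q, w) with hu'
    set b : V3 := Bi ξ (q, w) with hb
    have hb' : b = (2 : ℝ)⁻¹ • (w - u') := rfl
    have hnq : n = q + τ₀ • w := rfl
    have hΞi : shearAt i (fun z => -z j) z i = z i - z j := by
      rw [shearAt_apply_self, sub_eq_add_neg]
    have hΞk : ∀ k, k ≠ i → shearAt i (fun z => -z j) z k = z k := fun k hk => shearAt_apply_of_ne hk z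
    have hprojq : Literature.Analysis.FunctionSpaces.Torus.proj q = (z i).1 - (z j).1 := Torus.proj_reprSym _
    have hTq : T ξ (z i - z j) = (Literature.Analysis.FunctionSpaces.Torus.proj (n - τ₀ • u'), u') := rfl
    have hcq : c ξ (z i - z j) = (-Literature.Analysis.FunctionSpaces.Torus.proj (τ₀ • b), b) := rfl
    obtain ⟨HJi, HJj⟩ := lambertKick_apply_pair (ε := ε) hne z ξ hch
    change J ξ z i = ((z i).1 + Literature.Analysis.FunctionSpaces.Torus.proj (τ₀ • b), (z i).2 - b) at HJi
    change J ξ z j = ((z j).1 - Literature.Analysis.FunctionSpaces.Torus.proj (τ₀ • b), (z j).2 + b) at HJj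
    have HJk : ∀ k, k ≠ i → k ≠ j → J ξ z k = z k := fun k hki hkj =>
      lambertKick_apply_of_ne hki hkj _ z ξ
    funext k
    by_cases hki : k = i
    · subst hki
      rw [shearAt_apply_self, update_of_ne hne, update_self, hΞi, hTq, HJi, HJj]
      refine Prod.ext ?_ ?_
      · simp only [Prod.fst_add, Prod.fst_neg]
        have h1 : n - τ₀ • u' = q + (τ₀ • b + τ₀ • b) := by rw [hnq, hb']; module
        rw [h1, Literature.Analysis.FunctionSpaces.Torus.proj_add,
          Literature.Analysis.FunctionSpaces.Torus.proj_add, hprojq, neg_sub, sub_eq_add_neg]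
        abel
      · simp only [Prod.snd_add, Prod.snd_neg]
        rw [hb', hw]
        module
    by_cases hkj : k = j
    · subst hkj
      rw [shearAt_apply_of_ne hne.symm, update_self, hΞk k hne.symm, hΞi, hcq, HJj]
      refine Prod.ext ?_ rfl
      simp only [Prod.fst_add]
      exact sub_eq_add_neg _ _
    · rw [shearAt_apply_of_ne hki, update_of_ne hkj, update_of_ne hki, hΞk k hki, HJk k hki hkj]
  -- the relative-coordinate shear and its inverse
  set φ : Config N (Fin 3) T3 → T3 × V3 := fun z => -z j with hφ
  have hφm : Measurable φ := (measurable_pi_apply j).neg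
  have hφi : ∀ z a, φ (update z i a) = φ z := fun z a => by
    simp only [hφ, update_of_ne hne.symm]
  have hφi' : ∀ z a, (-φ) (update z i a) = (-φ) z := fun z a => by simp [hφi z a]
  -- the good one-particle data
  set D₀ : Set (T3 × V3) := {a | liftPhase a ∈ (billiardGood ε : Set (V3 × V3)) ∧
    pairHitTime ε (liftPhase a).1 (liftPhase a).2 ≤ δ ∧ ‖a.2‖ ≤ 2 * V} with hD₀
  have hD₀m : MeasurableSet D₀ :=
    (measurable_liftPhase (measurableSet_billiardGood ε)).inter
      ((measurableSet_le ((measurable_pairHitTime ε).comp measurable_liftPhase) measurable_const).inter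
        (measurableSet_le measurable_snd.norm measurable_const))
  have hDm : MeasurableSet {y : Config N (Fin 3) T3 | y i ∈ D₀} := (measurable_pi_apply i) hD₀m
  have hch : ε + δ * (2 * V) < 1 / 2 := by
    have h2 : (2⁻¹ : ℝ) = 1 / 2 := by norm_num
    nlinarith
  have hinv : ∀ g : T3 × V3 → ℝ≥0∞, Measurable g →
      ∫⁻ a in D₀, (∫⁻ ξ, g (T ξ a) ∂(stdGaussian V3)) = ∫⁻ a in D₀, g a :=
    fun g hg => lintegral_phase_redraw hε hδ hch hg
  -- measurability of the integrands
  set A : Set (Config N (Fin 3) T3) := hitPiece N ε r δ i j ∩ {z | configEnergy z ≤ V ^ 2 / 2} with hA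
  have hAm : MeasurableSet A := (measurableSet_hitPiece ε r δ i j).inter (measurableSet_energyShell _)
  have hΦm : Measurable fun z : Config N (Fin 3) T3 => ∫⁻ ξ, F (J ξ z) ∂(stdGaussian V3) :=
    (hF.comp (measurable_lambertPreKick ε i j)).lintegral_prod_right'
  have hGm : Measurable (F ∘ shearAt i (-φ)) := hF.comp (measurable_shearAt hφm.neg)
  -- the pointwise comparison after the change of variables
  have hpt : ∀ y : Config N (Fin 3) T3,
      A.indicator (fun z => ∫⁻ ξ, F (J ξ z) ∂(stdGaussian V3)) (shearAt i (-φ) y) ≤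
        {y : Config N (Fin 3) T3 | y i ∈ D₀}.indicator (fun y => ∫⁻ ξ, (F ∘ shearAt i (-φ))
          (update (update y i (T ξ (y i))) j (y j + c ξ (y i))) ∂(stdGaussian V3)) y := by
    intro y
    by_cases hy : shearAt i (-φ) y ∈ A
    · set z := shearAt i (-φ) y with hz
      have h : HitHyp ε r δ V z i j := HitHyp.mk hε hεr hr hV0 hy.2 hij hy.1
      have hΞz : shearAt i φ z = y := shearAt_shearAt_neg hφi y
      have hyi : y i = z i - z j := by
        rw [← hΞz, shearAt_apply_self, sub_eq_add_neg]
      have hyD : y ∈ {y : Config N (Fin 3) T3 | y i ∈ D₀} := by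
        show y i ∈ D₀
        rw [hyi]
        exact ⟨h.good, h.hitTime_le, norm_vel_sub_le h.norm_vel_le i j⟩
      rw [indicator_of_mem hy, indicator_of_mem hyD]
      refine le_of_eq (lintegral_congr fun ξ => ?_)
      have hchart := chart_bound h.norm_vel_le h.window h.chart h.norm_le
        (by rw [abs_of_pos h.hitTime_pos]; exact h.hitTime_le)
      show F (J ξ z) = F (shearAt i (-φ) (update (update y i (T ξ (y i))) j (y j + c ξ (y i))))
      rw [← hΞz, ← hfac z ξ hchart, shearAt_neg_shearAt hφi]
    · rw [indicator_of_notMem hy]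
      exact bot_le
  calc ∫⁻ z in A, ∫⁻ ξ, F (J ξ z) ∂(stdGaussian V3)
      = ∫⁻ z, A.indicator (fun z => ∫⁻ ξ, F (J ξ z) ∂(stdGaussian V3)) z :=
        (lintegral_indicator hAm _).symm
    _ = ∫⁻ y, A.indicator (fun z => ∫⁻ ξ, F (J ξ z) ∂(stdGaussian V3)) (shearAt i (-φ) y) :=
        (lintegral_comp_shearAt hφm.neg hφi' (hΦm.indicator hAm)).symm
    _ ≤ ∫⁻ y, {y : Config N (Fin 3) T3 | y i ∈ D₀}.indicator (fun y => ∫⁻ ξ, (F ∘ shearAt i (-φ))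
          (update (update y i (T ξ (y i))) j (y j + c ξ (y i))) ∂(stdGaussian V3)) y :=
        lintegral_mono hpt
    _ = ∫⁻ y in {y : Config N (Fin 3) T3 | y i ∈ D₀}, ∫⁻ ξ, (F ∘ shearAt i (-φ))
          (update (update y i (T ξ (y i))) j (y j + c ξ (y i))) ∂(stdGaussian V3) :=
        lintegral_indicator hDm _
    _ = ∫⁻ y in {y : Config N (Fin 3) T3 | y i ∈ D₀}, (F ∘ shearAt i (-φ)) y :=
        lintegral_lift_redraw (stdGaussian V3) hne hTm hcm hD₀m hinv hGm
    _ ≤ ∫⁻ y, (F ∘ shearAt i (-φ)) y := setLIntegral_le_lintegral _ _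
    _ = ∫⁻ z, F z := lintegral_comp_shearAt hφm.neg hφi' hF

/-- **The one-pair transport inequality of the Lambertian pre-kick**: for measurable `F ≥ 0`,
`∫_{hitPiece(r) ∩ shell} ∫ F (J_ξ z) dγ(ξ) dz ≤ ∫_{hitPiece(2Vδ) ∩ shell} F` (`4Vδ ≤ r`,
`ε + 2r < 1/2`): sub-invariance (`lintegral_lambertKick_le`) plus the support property
`J_ξ z ∈ hitPiece(2Vδ) ∩ shell` for a.e. `ξ` (`LWindow.hitHyp_lambertKick`); the annealed
Λ-analogue of `Alexander.volume_image_pairCollide`. [folklore] -/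
theorem lintegral_hitPiece_lambertKick_le (hε : 0 < ε) (hεr : ε + 2 * r < 2⁻¹) (hr4 : 4 * V * δ ≤ r)
    (hV0 : 0 ≤ V) (hδ : 0 ≤ δ) (hij : i < j) {F : Config N (Fin 3) T3 → ℝ≥0∞} (hF : Measurable F) :
    ∫⁻ z in hitPiece N ε r δ i j ∩ {z | configEnergy z ≤ V ^ 2 / 2},
        ∫⁻ ξ, F (freeFlight (Torus.geometry (Fin 3))
          (-pairHitTime ε ((Torus.geometry (Fin 3)).sepVec (z i).1 (z j).1) ((z i).2 - (z j).2))
          (collidePair (Torus.geometry (Fin 3)) i j (lambertPair (Torus.geometry (Fin 3)) i j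
            (freeFlight (Torus.geometry (Fin 3))
              (pairHitTime ε ((Torus.geometry (Fin 3)).sepVec (z i).1 (z j).1) ((z i).2 - (z j).2)) z) ξ)))
          ∂(stdGaussian V3) ≤
      ∫⁻ z in hitPiece N ε (2 * V * δ) δ i j ∩ {z | configEnergy z ≤ V ^ 2 / 2}, F z := by
  have hVδ : 0 ≤ 2 * V * δ := by positivity
  have hr2 : 2 * V * δ ≤ r := by linarith
  set J : V3 → Config N (Fin 3) T3 → Config N (Fin 3) T3 := fun ξ z => freeFlight (Torus.geometry (Fin 3))
    (-pairHitTime ε ((Torus.geometry (Fin 3)).sepVec (z i).1 (z j).1) ((z i).2 - (z j).2))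
    (collidePair (Torus.geometry (Fin 3)) i j (lambertPair (Torus.geometry (Fin 3)) i j
      (freeFlight (Torus.geometry (Fin 3))
        (pairHitTime ε ((Torus.geometry (Fin 3)).sepVec (z i).1 (z j).1) ((z i).2 - (z j).2)) z) ξ)) with hJ
  set A : Set (Config N (Fin 3) T3) := hitPiece N ε r δ i j ∩ {z | configEnergy z ≤ V ^ 2 / 2} with hA
  have hAm : MeasurableSet A := (measurableSet_hitPiece ε r δ i j).inter (measurableSet_energyShell _)
  set A' : Set (Config N (Fin 3) T3) := hitPiece N ε (2 * V * δ) δ i j ∩ {z | configEnergy z ≤ V ^ 2 / 2}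
    with hA'
  have hA'm : MeasurableSet A' :=
    (measurableSet_hitPiece ε (2 * V * δ) δ i j).inter (measurableSet_energyShell _)
  show ∫⁻ z in A, ∫⁻ ξ, F (J ξ z) ∂(stdGaussian V3) ≤ ∫⁻ z in A', F z
  -- the pre-kicked datum lies in the target piece, almost surely
  have hsupp : ∀ z ∈ A, ∀ᵐ ξ ∂(stdGaussian V3), J ξ z ∈ A' := by
    rintro z ⟨hz, hE⟩
    have h : HitHyp ε r δ V z i j := HitHyp.mk hε hεr hr2 hV0 hE hij hz
    filter_upwards [ae_stdGaussian_lambertDir_ne_zero_euclideanSpace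
      (hitPoint ε ((Torus.geometry (Fin 3)).sepVec (z i).1 (z j).1, (z i).2 - (z j).2))] with ξ hξ
    obtain ⟨hH, -, -⟩ := hitHyp_lambertKick h hr4 hξ
    exact ⟨hH.mem, hH.energy⟩
  have step : ∫⁻ z in A, ∫⁻ ξ, F (J ξ z) ∂(stdGaussian V3) =
      ∫⁻ z in A, ∫⁻ ξ, A'.indicator F (J ξ z) ∂(stdGaussian V3) := by
    refine setLIntegral_congr_fun hAm fun z hz => lintegral_congr_ae ?_
    filter_upwards [hsupp z hz] with ξ hξ
    rw [indicator_of_mem hξ]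
  rw [step, ← lintegral_indicator hA'm]
  exact lintegral_lambertKick_le hε hεr hr2 hV0 hδ hij (hF.indicator hA'm)

end Transport

/-! ## The stub -/

section Stub

/-- **The one-window step of the Liouville ⊗ noise invariance of the Lambertian hard-sphere flow on
`𝕋³`** (stub `stub_windowLambda` of line `Sketch` of crux `LambertianEuler`; Λ-analogue of
`Alexander.volume_shortGood_inter_preimage_fwdFlow_le` and `Alexander.fwdGoodUpTo_of_mem_shortGood`):
for `0 < ε`, `0 ≤ V`, `0 ≤ δ`, `4Vδ ≤ r`, `ε + 2r < 1/2`, (i) for every measurable `B` the annealed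
push-forward of `vol|_{shortGood(r) ∩ {E ≤ V²/2}} ⊗ γ^ℕ` under `Λ_δ` charges `B` at most `vol B`
(`window_measure_le_of_kick` with the pre-kick transport `lintegral_hitPiece_lambertKick_le`); (ii) for
every short-time good datum of the shell, almost surely the Lambertian collision instants pass `δ` and
`Λ_δ` lies in the hard-sphere domain (`window_ae`). [folklore] -/
theorem stub_windowLambda :
    ∀ {ε : ℝ}, 0 < ε → ∀ {N : ℕ} {V r δ : ℝ}, 0 ≤ V → 0 ≤ δ → 4 * V * δ ≤ r → ε + 2 * r < 2⁻¹ →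
      (∀ B : Set (Config N (Fin 3) T3), MeasurableSet B →
        ((volume.restrict {z : Config N (Fin 3) T3 |
            z ∈ shortGood N ε r δ ∧ configEnergy z ≤ V ^ 2 / 2}).prod (lambertNoise (Fin 3)))
          {p | lambertFlow (Torus.geometry (Fin 3)) ε p.2 p.1 δ ∈ B} ≤ volume B) ∧
      (∀ z : Config N (Fin 3) T3, z ∈ shortGood N ε r δ → configEnergy z ≤ V ^ 2 / 2 →
        ∀ᵐ ξs ∂(lambertNoise (Fin 3)),
          (∃ k, ENNReal.ofReal δ < lambertInstant (Torus.geometry (Fin 3)) ε ξs z k) ∧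
          lambertFlow (Torus.geometry (Fin 3)) ε ξs z δ ∈
            hardSphereDomain (Torus.geometry (Fin 3)) N ε) :=
  fun hε _ _ _ _ hV0 hδ hr4 hεr =>
    ⟨fun _ hB => window_measure_le_of_kick hε hV0 hδ hr4 hεr
        (fun _ _ hij _ hF => lintegral_hitPiece_lambertKick_le hε hεr hr4 hV0 hδ hij hF) hB,
      fun _ hz hE => window_ae hε hV0 hδ hr4 hεr hz hE⟩

end Stub

end LambertianContactSwapLambertianEulerWindow

end Summit.AtomisticToContinuum.HydrodynamicLimit.Theorems
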